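/-
Copyright (c) 2026 the pub-hodgecm-mathlib formalisation cell (harness21).  Prover seat hodgecm-mathlib-K2E1-p12 (g4) (free E1 analytic hand spilled to S8 per LEAD #21),
Track B ∕ K2-LIT, h413 = `stmt-HodgeConjecture-24833`, R90-TF section S8 «ContSpec-n½», deal S8-R68 (1) (2026-09-04T22:47:59Z): the N = 3 TWINS of ★ BLK-ISO p862633
`R90S8ResHBlockIsotypicU2` (K2E1-p15) and of ★ p862668 `R90S8IsoLeBlockProjectorFixedU2` §2 (R90-C133-p02) ON MOK'S CARRIER `quasiSplit L⁺ L c 3` — the Borel block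
`Sc(K′, ω; χ₁, χ₂)` is `(K′, ω)`-ISOTYPIC, and `Iso(K′, ω) ≤ V_P`; hence the `hScP` letter of ★ (N₃) p862676 is discharged on the G side.
-/
import Summits.HodgeConjecture.HodgeConjecture.Theorems.R90S8ResGBlockDataU3Defs              -- ★ G-DEFS (K2E1-p11 (g3)): `resGBlock ∕ resGAtom(Top∕Mid) ∕ resGLine` + read-backs; brings ★ `chiSectionSpacePair`, ★ `IsChiSectionPair.toAdelic_mul`, ★ `eisensteinSeriesU_rational_mul`, ★ `borelHeight_toAdelic_mul_of_mem_borelU`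
import Summits.HodgeConjecture.HodgeConjecture.Theorems.R90S8IsoLeBlockProjectorFixedU2          -- ★ p862668 (R90-C133-p02): §1 `iInf_eigenspace_le_eqLocus_blockProjector` — EVERY `N`, every `H` (★ `cm_blockProjector_eq_self_iff`)
import Literature.NumberTheory.Automorphic.AutomorphicRepsGLCuspidalUnitary                     -- ★ `AdelicGroupData.quotFun_rightTranslation`, `quotFun_smul`
import Literature.NumberTheory.Automorphic.UnitaryGroupKernelDictionary                          -- ★ `quotientSubgroup_quasiSplit` (every `N`)
import HarnessLib

/-!
# S8 #2 road (G side) — `R90S8ResGBlockIsotypicU3`: the Borel block `Sc(K′, ω; χ₁, χ₂)` of `U_{L∕L⁺}(3)` lies in the `(K′, ω)`-isotypic subspace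
# `Iso(K′, ω) = ⨅_{k ∈ K′} ker(R(k) − ω(k)·1)` (BLK-ISO₃), and `Iso(K′, ω) ≤ V_P` at `U(J₃)` — the `hScP` letter of ★ (N₃) discharged

Track B ∕ K2-LIT, crux h413 = `stmt-HodgeConjecture-24833`, route of record `HCCMUnconditional`; cell `hodgecm-mathlib`, R90-TF programme, section S8 «ContSpec-n½», socket #2
`sock_S8_res_classification` (B ED. 4 :205–:214; chain F1_qs ⟹ F2 ⟹ #2).  THEOREMS ONLY (no `def`, no `instance`, no `notation`, no named-fact hypothesis, no `sorry`; default
heartbeats); lane `--supports stmt-HodgeConjecture-24833 --as helper` (count-neutral).  CLOSES NO SOCKET.  WHY: the (N_blk,₃) payer ★ p862676 `resG_isotypic_le_orthogonal_lines` carries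
the visible letter `hScP : resGBlock L μ K' ω χ₁ χ₂ ≤ eqLocus P id` («the block lies in `V_P`»); `V_P ⊇ Iso(K′, ω)` by ★ `cm_blockProjector_eq_self_iff` (★ p862668 §1, every `N`), so what
is needed is `Sc ≤ Iso(K′, ω)` — proved here (§3) under the print's height-invariance letter `hHK′ : ∀ g k, k ∈ K′ → H(gk) = H(g)` and the AUTOMORPHY of the torus character `χ₂`
(`hχ₂ : TorusDict.IsAutomorphic c χ₂` — at `N = 3` the Borel datum is a PAIR `(χ₁, χ₂)`; `χ₁` is a Hecke character, automatic on principal ideles, `χ₂` a character of the norm-one torus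
`T(𝔸_F)` whose triviality on `T(F)` is the one place the wave packets' left-`G(F)`-invariance uses it, ★ `IsChiSectionPair.toAdelic_mul`); §4 composes with ★ p862668 §1 at `U(J₃)`.

THE MATHEMATICS ([MoeglinWaldspurger1995, II.1.1, II.1.5]; [BorelJacquet1979, §4.6]; the H-side proof ★ p862633 followed line by line with `chiSectionSpace χ ↦ chiSectionSpacePair χ₁ χ₂`).  For
`φ ∈ V(χ₁, χ₂; K′, ω)` (`φ(gk) = ω(k)φ(g)`, `k ∈ K′`) and `k ∈ K′` with `H(gk) = H(g)`: the profile `Ψ = (f∘H)·φ` satisfies `Ψ(gk) = ω(k)Ψ(g)`, hence so does its Eisenstein series `θ = E(Ψ)`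
(a sum over `B(F)∖G(F)` acting on the LEFT), i.e. `r(k)θ = ω(k)·θ`; `Ψ` is left-`B(F)`-invariant (§1, automorphy of `χ₂`), so `θ` is left-`G(F)`-invariant (★ `eisensteinSeriesU_rational_mul`,
★ `quotientSubgroup_quasiSplit`), and on the quotient `quotFun (r(k)θ) = quotFun θ (k⁻¹ • ·)` (★ `quotFun_rightTranslation`), `(R(k)[θ])(x) = [θ](k⁻¹ • x)` a.e. (★ `rightRegular_apply_coeFn`):
`R(k)[θ] = ω(k)·[θ]` in `L²` (§2).  The isotypic subspace is closed, so the CLOSED span `Sc` of the `[θ]` lies in it (§3); `Iso(K′, ω) ≤ V_P` is ★ p862668 §1 at `π := R` on `L²(U(J₃))` (§4).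
* §1 `pairRadialSection_toAdelic_mul`, `eisensteinSeriesU_pairRadialSection_quotientSubgroup_mul` — left-`B(F)`- ∕ left-`G(F)`-invariance of the profile ∕ the wave packet (visible `hχ₂`).
* §2 **`rightRegular_apply_toLp_pairBrick_eq_smul`** — `R(k)[θ_{f,φ}] = ω(k) • [θ_{f,φ}]` for `k ∈ K′`, `φ ∈ V(χ₁, χ₂; K′, ω)`, under `hHK′`, `hχ₂`.
* §3 `isClosed_iInf_eigenspace_rightRegular_three`, **`resGBlock_le_iInf_eigenspace`** (BLK-ISO₃), `resGAtom∕resGAtomTop∕resGAtomMid∕resGLine_le_iInf_eigenspace` — «`At ≤ Iso`», «`Ln ≤ Iso`» for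
  ANY three-slot block-model map `U`.
* §4 `iso_le_eqLocus_blockProjector_quasiSplit_three` (★ p862668 §1 at `U(J₃)`, `π := R`) and **`resGBlock_le_eqLocus_blockProjector`** = the `hScP` letter of ★ (N₃) `resG_isotypic_le_orthogonal_lines`
  BY NAME, modulo `hHK′`, `hχ₂` and the generator memberships∕values `hKf hKκ hωf hωκ` of the block projector (as on the H side).
HONEST LABEL: HC_CM is proved only modulo the 7 printed citations (2 remaining named inputs: hLiu418 = `stmt-HodgeConjecture-24832`, h413 = `stmt-HodgeConjecture-24833`) until
rung 0 closes; REL ≠ ★ ≠ BUILT; this file asserts no named fact, is conditional by construction on its visible binders (`hHK′`, `hχ₂`, the projector data), and closes no socket; count-neutral.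

## References
* [MoeglinWaldspurger1995] C. Mœglin, J.-L. Waldspurger, *Spectral Decomposition and Eisenstein Series* (1995), II.1.1, II.1.5.
* [BorelJacquet1979] A. Borel, H. Jacquet, *Automorphic forms and automorphic representations*, Corvallis PSPM 33.1 (1979), §4.1, §4.6.
* [Knapp1986] A. W. Knapp, *Representation theory of semisimple groups*, Princeton (1986), Ch. VIII §3.
-/

set_option autoImplicit false
set_option linter.dupNamespace false  -- the mandated namespace `…HodgeConjecture.HodgeConjecture.R90.S8` (LEAD #1 L1) repeats the summit's segment

noncomputable section

open MeasureTheory Measure Set Filter Topology NumberField CompactlySupported ContRepresentation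
open Literature.NumberTheory Literature.NumberTheory.Automorphic Literature.NumberTheory.Automorphic.UnitaryGroup Literature.NumberTheory.GaloisRepresentations AdelicGroupData
open Literature.NumberTheory.Automorphic.Arthur2013.Leaves.TECR
open Summit.HodgeConjecture.HodgeConjecture.Cruxes.H413.K2E1BorelEisensteinU
open Summit.HodgeConjecture.HodgeConjecture.Cruxes.H413.K2E1CharacterEisensteinU3PairDefs
open Summit.HodgeConjecture.HodgeConjecture.Cruxes.H413.K2E1ChiSectionSpaceU3PairDefs
open scoped ENNReal NNReal InnerProductSpace ComplexConjugate

namespace Summit.HodgeConjecture.HodgeConjecture.R90.S8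

section BlkIso

variable (L : Type) [Field L] [NumberField L] [IsCMField L]
  [MeasurableSpace (quasiSplit (↥(maximalRealSubfield L)) L (IsCMField.complexConj L) 3).Adelic] [BorelSpace (quasiSplit (↥(maximalRealSubfield L)) L (IsCMField.complexConj L) 3).Adelic]
  (μ : Measure (quasiSplit (↥(maximalRealSubfield L)) L (IsCMField.complexConj L) 3).automorphicQuotient) [(quasiSplit (↥(maximalRealSubfield L)) L (IsCMField.complexConj L) 3).IsAutomorphicMeasure μ]

/-! ## §1 The profile `(f∘H)·φ` and its wave packet are left-`B(F)`- ∕ left-`G(F)`-invariant (automorphy of `χ₂`) -/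

omit [MeasurableSpace (quasiSplit (↥(maximalRealSubfield L)) L (IsCMField.complexConj L) 3).Adelic] [BorelSpace (quasiSplit (↥(maximalRealSubfield L)) L (IsCMField.complexConj L) 3).Adelic] in
/-- `(f∘H)·φ` is left-`B(F)`-invariant for a `(χ₁, χ₂)`-pair-section `φ` with `χ₂` AUTOMORPHIC (★ `IsChiSectionPair.toAdelic_mul`, ★ `borelHeight_toAdelic_mul_of_mem_borelU`) — the N = 3 twin of
★ `radialSection_toAdelic_mul`. [cite: MoeglinWaldspurger1995, II.1.5] -/
theorem pairRadialSection_toAdelic_mul {χ₁ : HeckeCharacter L} {χ₂ : ↥(TorusDict.torus (IsCMField.complexConj L)) →ₜ* ℂˣ} {φ : (quasiSplit (↥(maximalRealSubfield L)) L (IsCMField.complexConj L) 3).Adelic → ℂ}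
    (hφ : IsChiSectionPair χ₁ χ₂ φ) (hχ₂ : TorusDict.IsAutomorphic (IsCMField.complexConj L) χ₂) (f : ℝ → ℂ) :
    ∀ b ∈ borelU ((IsCMField.complexConj L : L ≃ₐ[↥(maximalRealSubfield L)] L) : L →+* L) ((StdForm.antidiagonal 3).over L), ∀ x : (quasiSplit (↥(maximalRealSubfield L)) L (IsCMField.complexConj L) 3).Adelic,
      (fun x : (quasiSplit (↥(maximalRealSubfield L)) L (IsCMField.complexConj L) 3).Adelic => f (borelHeight x : ℝ) * φ x) ((quasiSplit (↥(maximalRealSubfield L)) L (IsCMField.complexConj L) 3).toAdelic b * x) = (fun x : (quasiSplit (↥(maximalRealSubfield L)) L (IsCMField.complexConj L) 3).Adelic => f (borelHeight x : ℝ) * φ x) x := by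
  intro b hb x
  simp only [IsChiSectionPair.toAdelic_mul hφ hχ₂ b hb x, borelHeight_toAdelic_mul_of_mem_borelU hb x]

omit [MeasurableSpace (quasiSplit (↥(maximalRealSubfield L)) L (IsCMField.complexConj L) 3).Adelic] [BorelSpace (quasiSplit (↥(maximalRealSubfield L)) L (IsCMField.complexConj L) 3).Adelic] in
/-- **`E((f∘H)·φ)` IS LEFT-`A_G G(F)`-INVARIANT** for a pair-section `φ` with `χ₂` automorphic (`A_G = 1`, ★ `quotientSubgroup_quasiSplit`; ★ `eisensteinSeriesU_rational_mul`) — the N = 3 twin of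
★ `eisensteinSeriesU_radialSection_quotientSubgroup_mul`. [cite: MoeglinWaldspurger1995, II.1.5] -/
theorem eisensteinSeriesU_pairRadialSection_quotientSubgroup_mul {χ₁ : HeckeCharacter L} {χ₂ : ↥(TorusDict.torus (IsCMField.complexConj L)) →ₜ* ℂˣ} {φ : (quasiSplit (↥(maximalRealSubfield L)) L (IsCMField.complexConj L) 3).Adelic → ℂ}
    (hφ : IsChiSectionPair χ₁ χ₂ φ) (hχ₂ : TorusDict.IsAutomorphic (IsCMField.complexConj L) χ₂) (f : ℝ → ℂ) :
    ∀ γ ∈ (quasiSplit (↥(maximalRealSubfield L)) L (IsCMField.complexConj L) 3).quotientSubgroup, ∀ g : (quasiSplit (↥(maximalRealSubfield L)) L (IsCMField.complexConj L) 3).Adelic,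
      eisensteinSeriesU (fun x : (quasiSplit (↥(maximalRealSubfield L)) L (IsCMField.complexConj L) 3).Adelic => f (borelHeight x : ℝ) * φ x) (γ * g) = eisensteinSeriesU (fun x : (quasiSplit (↥(maximalRealSubfield L)) L (IsCMField.complexConj L) 3).Adelic => f (borelHeight x : ℝ) * φ x) g := by
  intro γ hγ g
  rw [quotientSubgroup_quasiSplit] at hγ
  obtain ⟨γ', hγ'⟩ := MonoidHom.mem_range.1 hγ
  rw [← hγ']
  exact eisensteinSeriesU_rational_mul (pairRadialSection_toAdelic_mul L hφ hχ₂ f) γ' g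

/-! ## §2 Each wave packet `[θ_{f,φ}]` is a `(K′, ω)`-eigenvector -/

/-- **`R(k)[θ_{f,φ}] = ω(k) • [θ_{f,φ}]`** for `k ∈ K′` and `φ ∈ V(χ₁, χ₂; K′, ω)`, when `K′` preserves the Borel height (`hHK′`) and `χ₂` is automorphic (`hχ₂`): the profile `(f∘H)·φ` and hence its
Eisenstein series transform by `ω(k)` under right translation by `k`; ★ `quotFun_rightTranslation` + ★ `rightRegular_apply_coeFn` carry this to `L²` — the N = 3 twin of ★
`rightRegular_apply_toLp_brick_eq_smul`, same proof. [cite: MoeglinWaldspurger1995, II.1.1, II.1.5] [cite: BorelJacquet1979, §4.6] -/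
theorem rightRegular_apply_toLp_pairBrick_eq_smul (K' : Subgroup (quasiSplit (↥(maximalRealSubfield L)) L (IsCMField.complexConj L) 3).Adelic) (ω : ↥K' →* ℂ)
    (hHK' : ∀ (g k : (quasiSplit (↥(maximalRealSubfield L)) L (IsCMField.complexConj L) 3).Adelic), k ∈ K' → borelHeight (g * k) = borelHeight g)
    {χ₁ : HeckeCharacter L} {χ₂ : ↥(TorusDict.torus (IsCMField.complexConj L)) →ₜ* ℂˣ} (hχ₂ : TorusDict.IsAutomorphic (IsCMField.complexConj L) χ₂)
    {f : ℝ → ℂ} {φ : (quasiSplit (↥(maximalRealSubfield L)) L (IsCMField.complexConj L) 3).Adelic → ℂ} (hφ : φ ∈ chiSectionSpacePair χ₁ χ₂ K' (ω : ↥K' → ℂ))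
    (hv : MemLp ((quasiSplit (↥(maximalRealSubfield L)) L (IsCMField.complexConj L) 3).quotFun (eisensteinSeriesU (fun g : (quasiSplit (↥(maximalRealSubfield L)) L (IsCMField.complexConj L) 3).Adelic => f (borelHeight g : ℝ) * φ g))) 2 μ)
    {k : (quasiSplit (↥(maximalRealSubfield L)) L (IsCMField.complexConj L) 3).Adelic} (hk : k ∈ K') :
    ((quasiSplit (↥(maximalRealSubfield L)) L (IsCMField.complexConj L) 3).rightRegular μ) k (hv.toLp _) = ω ⟨k, hk⟩ • hv.toLp _ := by
  -- the profile and its Eisenstein series transform by `ω(k)` under `g ↦ g k`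
  have hφk : ∀ g : (quasiSplit (↥(maximalRealSubfield L)) L (IsCMField.complexConj L) 3).Adelic, φ (g * k) = ω ⟨k, hk⟩ * φ g := fun g => apply_mul_of_mem hφ g ⟨k, hk⟩
  have hF : ∀ g : (quasiSplit (↥(maximalRealSubfield L)) L (IsCMField.complexConj L) 3).Adelic, f (borelHeight (g * k) : ℝ) * φ (g * k) = ω ⟨k, hk⟩ * (f (borelHeight g : ℝ) * φ g) := fun g => by
    rw [hHK' g k hk, hφk g]; ring
  have hE : ∀ g : (quasiSplit (↥(maximalRealSubfield L)) L (IsCMField.complexConj L) 3).Adelic,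
      eisensteinSeriesU (fun g : (quasiSplit (↥(maximalRealSubfield L)) L (IsCMField.complexConj L) 3).Adelic => f (borelHeight g : ℝ) * φ g) (g * k) = ω ⟨k, hk⟩ * eisensteinSeriesU (fun g : (quasiSplit (↥(maximalRealSubfield L)) L (IsCMField.complexConj L) 3).Adelic => f (borelHeight g : ℝ) * φ g) g := fun g => by
    rw [eisensteinSeriesU_def, eisensteinSeriesU_def, ← tsum_mul_left]
    exact tsum_congr fun q => by rw [← mul_assoc]; exact hF _
  -- right translation on `G(𝔸)` = the left action on the quotient
  have hinv := eisensteinSeriesU_pairRadialSection_quotientSubgroup_mul L (isChiSectionPair_of_mem hφ) hχ₂ f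
  have hrt : rightTranslation (quasiSplit (↥(maximalRealSubfield L)) L (IsCMField.complexConj L) 3) k (eisensteinSeriesU (fun g : (quasiSplit (↥(maximalRealSubfield L)) L (IsCMField.complexConj L) 3).Adelic => f (borelHeight g : ℝ) * φ g)) =
      ω ⟨k, hk⟩ • eisensteinSeriesU (fun g : (quasiSplit (↥(maximalRealSubfield L)) L (IsCMField.complexConj L) 3).Adelic => f (borelHeight g : ℝ) * φ g) :=
    funext fun g => by rw [rightTranslation_apply, hE, Pi.smul_apply, smul_eq_mul]
  have h3 := AdelicGroupData.quotFun_rightTranslation hinv k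
  rw [hrt, AdelicGroupData.quotFun_smul] at h3
  -- compare a.e. on the quotient
  apply Lp.ext
  have h1 := (quasiSplit (↥(maximalRealSubfield L)) L (IsCMField.complexConj L) 3).rightRegular_apply_coeFn μ k (hv.toLp _)
  have h2 := (measurePreserving_smul k⁻¹ μ).quasiMeasurePreserving.ae_eq_comp hv.coeFn_toLp
  refine h1.trans (h2.trans ?_)
  refine Filter.EventuallyEq.trans (Filter.Eventually.of_forall fun x => (congrFun h3 x).symm) ?_
  refine Filter.EventuallyEq.trans ?_ (Lp.coeFn_smul _ _).symm
  exact hv.coeFn_toLp.symm.const_smul (ω ⟨k, hk⟩)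

/-! ## §3 The block, its atoms and its lines are `(K′, ω)`-isotypic (BLK-ISO₃) -/

omit [MeasurableSpace (quasiSplit (↥(maximalRealSubfield L)) L (IsCMField.complexConj L) 3).Adelic] [BorelSpace (quasiSplit (↥(maximalRealSubfield L)) L (IsCMField.complexConj L) 3).Adelic] in
/-- The `(K′, ω)`-isotypic subspace `⨅_{k ∈ K′} ker(R(k) − ω(k))` of `L²(U(J₃))` is closed (an intersection of equalisers of continuous maps) — the N = 3 copy of ★
`isClosed_iInf_eigenspace_rightRegular`. [folklore] -/
theorem isClosed_iInf_eigenspace_rightRegular_three (K' : Subgroup (quasiSplit (↥(maximalRealSubfield L)) L (IsCMField.complexConj L) 3).Adelic) (ω : ↥K' →* ℂ) :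
    IsClosed (((⨅ k : ↥K', Module.End.eigenspace ((((quasiSplit (↥(maximalRealSubfield L)) L (IsCMField.complexConj L) 3).rightRegular μ) (K'.subtype k) :
        (quasiSplit (↥(maximalRealSubfield L)) L (IsCMField.complexConj L) 3).L2 μ →L[ℂ] (quasiSplit (↥(maximalRealSubfield L)) L (IsCMField.complexConj L) 3).L2 μ) :
        (quasiSplit (↥(maximalRealSubfield L)) L (IsCMField.complexConj L) 3).L2 μ →ₗ[ℂ] (quasiSplit (↥(maximalRealSubfield L)) L (IsCMField.complexConj L) 3).L2 μ) (ω k)) : Submodule ℂ ((quasiSplit (↥(maximalRealSubfield L)) L (IsCMField.complexConj L) 3).L2 μ)) : Set ((quasiSplit (↥(maximalRealSubfield L)) L (IsCMField.complexConj L) 3).L2 μ)) := by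
  rw [Submodule.coe_iInf]
  refine isClosed_iInter fun k => ?_
  have hset : ((Module.End.eigenspace ((((quasiSplit (↥(maximalRealSubfield L)) L (IsCMField.complexConj L) 3).rightRegular μ) (K'.subtype k) :
        (quasiSplit (↥(maximalRealSubfield L)) L (IsCMField.complexConj L) 3).L2 μ →L[ℂ] (quasiSplit (↥(maximalRealSubfield L)) L (IsCMField.complexConj L) 3).L2 μ) :
        (quasiSplit (↥(maximalRealSubfield L)) L (IsCMField.complexConj L) 3).L2 μ →ₗ[ℂ] (quasiSplit (↥(maximalRealSubfield L)) L (IsCMField.complexConj L) 3).L2 μ) (ω k) :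
        Submodule ℂ ((quasiSplit (↥(maximalRealSubfield L)) L (IsCMField.complexConj L) 3).L2 μ)) : Set ((quasiSplit (↥(maximalRealSubfield L)) L (IsCMField.complexConj L) 3).L2 μ)) =
      {x | ((quasiSplit (↥(maximalRealSubfield L)) L (IsCMField.complexConj L) 3).rightRegular μ) (K'.subtype k) x = ω k • x} :=
    Set.ext fun x => Module.End.mem_eigenspace_iff
  rw [hset]
  exact isClosed_eq (((quasiSplit (↥(maximalRealSubfield L)) L (IsCMField.complexConj L) 3).rightRegular μ) (K'.subtype k)).continuous (continuous_const_smul (ω k))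

/-- **BLK-ISO₃ — THE BOREL BLOCK IS `(K′, ω)`-ISOTYPIC**: under the height-invariance letter `hHK′` and automorphy of `χ₂`, `Sc(K′, ω; χ₁, χ₂) ≤ ⨅_{k ∈ K′} ker(R(k) − ω(k))` — the generating wave
packets are eigenvectors (§2) and the isotypic subspace is closed. [cite: MoeglinWaldspurger1995, II.1.1, II.1.5] [cite: BorelJacquet1979, §4.6] -/
theorem resGBlock_le_iInf_eigenspace (K' : Subgroup (quasiSplit (↥(maximalRealSubfield L)) L (IsCMField.complexConj L) 3).Adelic) (ω : ↥K' →* ℂ)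
    (hHK' : ∀ (g k : (quasiSplit (↥(maximalRealSubfield L)) L (IsCMField.complexConj L) 3).Adelic), k ∈ K' → borelHeight (g * k) = borelHeight g)
    (χ₁ : HeckeCharacter L) {χ₂ : ↥(TorusDict.torus (IsCMField.complexConj L)) →ₜ* ℂˣ} (hχ₂ : TorusDict.IsAutomorphic (IsCMField.complexConj L) χ₂) :
    resGBlock L μ K' ω χ₁ χ₂ ≤ ⨅ k : ↥K', Module.End.eigenspace ((((quasiSplit (↥(maximalRealSubfield L)) L (IsCMField.complexConj L) 3).rightRegular μ) (K'.subtype k) :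
        (quasiSplit (↥(maximalRealSubfield L)) L (IsCMField.complexConj L) 3).L2 μ →L[ℂ] (quasiSplit (↥(maximalRealSubfield L)) L (IsCMField.complexConj L) 3).L2 μ) :
        (quasiSplit (↥(maximalRealSubfield L)) L (IsCMField.complexConj L) 3).L2 μ →ₗ[ℂ] (quasiSplit (↥(maximalRealSubfield L)) L (IsCMField.complexConj L) 3).L2 μ) (ω k) := by
  rw [resGBlock_def]
  refine Submodule.topologicalClosure_minimal _ (Submodule.span_le.2 ?_) (isClosed_iInf_eigenspace_rightRegular_three L μ K' ω)
  rintro v ⟨f, hf, hfs, hf0, φ, hφ, hφc, hv, rfl⟩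
  refine (Submodule.mem_iInf _).2 fun k => Module.End.mem_eigenspace_iff.2 ?_
  exact rightRegular_apply_toLp_pairBrick_eq_smul L μ K' ω hHK' hχ₂ hφ hv k.2

variable {A M Λ : Type*} [AddCommGroup A] [Module ℂ A] [AddCommGroup M] [Module ℂ M] [AddCommGroup Λ] [Module ℂ Λ]
  (U : (quasiSplit (↥(maximalRealSubfield L)) L (IsCMField.complexConj L) 3).L2 μ →ₗ[ℂ] (A × M) × Λ)

/-- `At ≤ Iso(K′, ω)` (BLK-ISO₃ ∘ ★ `resGAtom_le_resGBlock`), for ANY three-slot block-model map `U`. [cite: MoeglinWaldspurger1995, II.1.5] -/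
theorem resGAtom_le_iInf_eigenspace (K' : Subgroup (quasiSplit (↥(maximalRealSubfield L)) L (IsCMField.complexConj L) 3).Adelic) (ω : ↥K' →* ℂ)
    (hHK' : ∀ (g k : (quasiSplit (↥(maximalRealSubfield L)) L (IsCMField.complexConj L) 3).Adelic), k ∈ K' → borelHeight (g * k) = borelHeight g)
    (χ₁ : HeckeCharacter L) {χ₂ : ↥(TorusDict.torus (IsCMField.complexConj L)) →ₜ* ℂˣ} (hχ₂ : TorusDict.IsAutomorphic (IsCMField.complexConj L) χ₂) :
    resGAtom L μ U K' ω χ₁ χ₂ ≤ ⨅ k : ↥K', Module.End.eigenspace ((((quasiSplit (↥(maximalRealSubfield L)) L (IsCMField.complexConj L) 3).rightRegular μ) (K'.subtype k) :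
        (quasiSplit (↥(maximalRealSubfield L)) L (IsCMField.complexConj L) 3).L2 μ →L[ℂ] (quasiSplit (↥(maximalRealSubfield L)) L (IsCMField.complexConj L) 3).L2 μ) :
        (quasiSplit (↥(maximalRealSubfield L)) L (IsCMField.complexConj L) 3).L2 μ →ₗ[ℂ] (quasiSplit (↥(maximalRealSubfield L)) L (IsCMField.complexConj L) 3).L2 μ) (ω k) :=
  (resGAtom_le_resGBlock L μ U K' ω χ₁ χ₂).trans (resGBlock_le_iInf_eigenspace L μ K' ω hHK' χ₁ hχ₂)

/-- `At_top ≤ Iso(K′, ω)` (BLK-ISO₃ ∘ ★ `resGAtomTop_le_resGBlock`). [cite: MoeglinWaldspurger1995, II.1.5] -/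
theorem resGAtomTop_le_iInf_eigenspace (K' : Subgroup (quasiSplit (↥(maximalRealSubfield L)) L (IsCMField.complexConj L) 3).Adelic) (ω : ↥K' →* ℂ)
    (hHK' : ∀ (g k : (quasiSplit (↥(maximalRealSubfield L)) L (IsCMField.complexConj L) 3).Adelic), k ∈ K' → borelHeight (g * k) = borelHeight g)
    (χ₁ : HeckeCharacter L) {χ₂ : ↥(TorusDict.torus (IsCMField.complexConj L)) →ₜ* ℂˣ} (hχ₂ : TorusDict.IsAutomorphic (IsCMField.complexConj L) χ₂) :
    resGAtomTop L μ U K' ω χ₁ χ₂ ≤ ⨅ k : ↥K', Module.End.eigenspace ((((quasiSplit (↥(maximalRealSubfield L)) L (IsCMField.complexConj L) 3).rightRegular μ) (K'.subtype k) :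
        (quasiSplit (↥(maximalRealSubfield L)) L (IsCMField.complexConj L) 3).L2 μ →L[ℂ] (quasiSplit (↥(maximalRealSubfield L)) L (IsCMField.complexConj L) 3).L2 μ) :
        (quasiSplit (↥(maximalRealSubfield L)) L (IsCMField.complexConj L) 3).L2 μ →ₗ[ℂ] (quasiSplit (↥(maximalRealSubfield L)) L (IsCMField.complexConj L) 3).L2 μ) (ω k) :=
  (resGAtomTop_le_resGBlock L μ U K' ω χ₁ χ₂).trans (resGBlock_le_iInf_eigenspace L μ K' ω hHK' χ₁ hχ₂)

/-- `At_mid ≤ Iso(K′, ω)` (BLK-ISO₃ ∘ ★ `resGAtomMid_le_resGBlock`). [cite: MoeglinWaldspurger1995, II.1.5] -/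
theorem resGAtomMid_le_iInf_eigenspace (K' : Subgroup (quasiSplit (↥(maximalRealSubfield L)) L (IsCMField.complexConj L) 3).Adelic) (ω : ↥K' →* ℂ)
    (hHK' : ∀ (g k : (quasiSplit (↥(maximalRealSubfield L)) L (IsCMField.complexConj L) 3).Adelic), k ∈ K' → borelHeight (g * k) = borelHeight g)
    (χ₁ : HeckeCharacter L) {χ₂ : ↥(TorusDict.torus (IsCMField.complexConj L)) →ₜ* ℂˣ} (hχ₂ : TorusDict.IsAutomorphic (IsCMField.complexConj L) χ₂) :
    resGAtomMid L μ U K' ω χ₁ χ₂ ≤ ⨅ k : ↥K', Module.End.eigenspace ((((quasiSplit (↥(maximalRealSubfield L)) L (IsCMField.complexConj L) 3).rightRegular μ) (K'.subtype k) :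
        (quasiSplit (↥(maximalRealSubfield L)) L (IsCMField.complexConj L) 3).L2 μ →L[ℂ] (quasiSplit (↥(maximalRealSubfield L)) L (IsCMField.complexConj L) 3).L2 μ) :
        (quasiSplit (↥(maximalRealSubfield L)) L (IsCMField.complexConj L) 3).L2 μ →ₗ[ℂ] (quasiSplit (↥(maximalRealSubfield L)) L (IsCMField.complexConj L) 3).L2 μ) (ω k) :=
  (resGAtomMid_le_resGBlock L μ U K' ω χ₁ χ₂).trans (resGBlock_le_iInf_eigenspace L μ K' ω hHK' χ₁ hχ₂)

/-- `Ln ≤ Iso(K′, ω)` — the `hLnP`-type input, for ANY three-slot block-model map `U` (BLK-ISO₃ ∘ ★ `resGLine_le_resGBlock`). [cite: MoeglinWaldspurger1995, II.1.5] -/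
theorem resGLine_le_iInf_eigenspace (K' : Subgroup (quasiSplit (↥(maximalRealSubfield L)) L (IsCMField.complexConj L) 3).Adelic) (ω : ↥K' →* ℂ)
    (hHK' : ∀ (g k : (quasiSplit (↥(maximalRealSubfield L)) L (IsCMField.complexConj L) 3).Adelic), k ∈ K' → borelHeight (g * k) = borelHeight g)
    (χ₁ : HeckeCharacter L) {χ₂ : ↥(TorusDict.torus (IsCMField.complexConj L)) →ₜ* ℂˣ} (hχ₂ : TorusDict.IsAutomorphic (IsCMField.complexConj L) χ₂) :
    resGLine L μ U K' ω χ₁ χ₂ ≤ ⨅ k : ↥K', Module.End.eigenspace ((((quasiSplit (↥(maximalRealSubfield L)) L (IsCMField.complexConj L) 3).rightRegular μ) (K'.subtype k) :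
        (quasiSplit (↥(maximalRealSubfield L)) L (IsCMField.complexConj L) 3).L2 μ →L[ℂ] (quasiSplit (↥(maximalRealSubfield L)) L (IsCMField.complexConj L) 3).L2 μ) :
        (quasiSplit (↥(maximalRealSubfield L)) L (IsCMField.complexConj L) 3).L2 μ →ₗ[ℂ] (quasiSplit (↥(maximalRealSubfield L)) L (IsCMField.complexConj L) 3).L2 μ) (ω k) :=
  (resGLine_le_resGBlock L μ U K' ω χ₁ χ₂).trans (resGBlock_le_iInf_eigenspace L μ K' ω hHK' χ₁ hχ₂)

end BlkIso

/-! ## §4 `Iso(K′, ω) ≤ V_P` at `U(J₃)` (★ p862668 §1 at `π := R`) and the `hScP` letter of ★ (N₃) discharged -/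

section Print

variable (L : Type) [Field L] [NumberField L] [IsCMField L]
  (μ : Measure (quasiSplit (↥(maximalRealSubfield L)) L (IsCMField.complexConj L) 3).automorphicQuotient)
  [(quasiSplit (↥(maximalRealSubfield L)) L (IsCMField.complexConj L) 3).IsAutomorphicMeasure μ]
  {K : Type*} [Group K] [TopologicalSpace K] [MeasurableSpace K] [BorelSpace K]
  [MeasurableSpace (finAdelic (↥(maximalRealSubfield L)) L (IsCMField.complexConj L) 3 ((StdForm.antidiagonal 3).over L))] [BorelSpace (finAdelic (↥(maximalRealSubfield L)) L (IsCMField.complexConj L) 3 ((StdForm.antidiagonal 3).over L))]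
  (νf : Measure (finAdelic (↥(maximalRealSubfield L)) L (IsCMField.complexConj L) 3 ((StdForm.antidiagonal 3).over L))) [IsFiniteMeasureOnCompacts νf] [νf.IsMulLeftInvariant]
  (κ : K →* UnitaryGroup.arch (↥(maximalRealSubfield L)) L (IsCMField.complexConj L) 3 ((StdForm.antidiagonal 3).over L)) (hκ : Continuous κ)
  (μK : Measure K) [IsFiniteMeasureOnCompacts μK] [IsProbabilityMeasure μK] [MeasurableMul K] [μK.IsMulLeftInvariant]
  (χ : C_c(K, ℂ)) (e : C_c(finAdelic (↥(maximalRealSubfield L)) L (IsCMField.complexConj L) 3 ((StdForm.antidiagonal 3).over L), ℂ))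

/-- **`Iso(K′, ω) ≤ V_P` AT `U(J₃)`, `π := R` on `L²(μ)`** — the N = 3 copy of ★ `iso_le_eqLocus_blockProjector_quasiSplit` (one `exact` over ★ p862668 §1, every `N`): under the generator
memberships and values (`hKf hKκ hωf hωκ`) of the block projector `P = P_χ ∘L R_f(e)`, `Iso(K′, ω) ≤ eqLocus P id`. [cite: Knapp1986, VIII §3] [cite: BorelJacquet1979, §4.1] -/
theorem iso_le_eqLocus_blockProjector_quasiSplit_three
    (hχmul : ∀ k l, χ (k * l) = χ k * χ l) (hχone : χ 1 = 1)
    (U₀ : Subgroup (finAdelic (↥(maximalRealSubfield L)) L (IsCMField.complexConj L) 3 ((StdForm.antidiagonal 3).over L))) (he0 : ∀ g, g ∉ U₀ → e g = 0) (he1 : ∫ g, e g ∂νf = 1)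
    (heK : ∀ k ∈ U₀, ∀ x, e (k * x) = e x)
    (P : (quasiSplit (↥(maximalRealSubfield L)) L (IsCMField.complexConj L) 3).L2 μ →L[ℂ] (quasiSplit (↥(maximalRealSubfield L)) L (IsCMField.complexConj L) 3).L2 μ)
    (hPdef : P = ((((quasiSplit (↥(maximalRealSubfield L)) L (IsCMField.complexConj L) 3).rightRegular μ).restrict ((archToAdelic (↥(maximalRealSubfield L)) L (IsCMField.complexConj L) 3 ((StdForm.antidiagonal 3).over L)).comp κ)).integratedOperator (((quasiSplit (↥(maximalRealSubfield L)) L (IsCMField.complexConj L) 3).isUnitary_rightRegular μ).restrict _)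
          (((quasiSplit (↥(maximalRealSubfield L)) L (IsCMField.complexConj L) 3).isStronglyContinuous_rightRegular_holds μ).restrict _ ((continuous_archToAdelic (↥(maximalRealSubfield L)) L (IsCMField.complexConj L) 3 ((StdForm.antidiagonal 3).over L)).comp hκ)) μK χ ∘L
        (((quasiSplit (↥(maximalRealSubfield L)) L (IsCMField.complexConj L) 3).rightRegular μ).restrict (finAdelicToAdelic (↥(maximalRealSubfield L)) L (IsCMField.complexConj L) 3 ((StdForm.antidiagonal 3).over L))).integratedOperator (((quasiSplit (↥(maximalRealSubfield L)) L (IsCMField.complexConj L) 3).isUnitary_rightRegular μ).restrict _) (((quasiSplit (↥(maximalRealSubfield L)) L (IsCMField.complexConj L) 3).isStronglyContinuous_rightRegular_holds μ).restrict _ (continuous_finAdelicToAdelic (↥(maximalRealSubfield L)) L (IsCMField.complexConj L) 3 ((StdForm.antidiagonal 3).over L))) νf e))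
    (K' : Subgroup (quasiSplit (↥(maximalRealSubfield L)) L (IsCMField.complexConj L) 3).Adelic) (ω : ↥K' →* ℂ)
    (hKf : ∀ k ∈ U₀, finAdelicToAdelic (↥(maximalRealSubfield L)) L (IsCMField.complexConj L) 3 ((StdForm.antidiagonal 3).over L) k ∈ K')
    (hKκ : ∀ k : K, archToAdelic (↥(maximalRealSubfield L)) L (IsCMField.complexConj L) 3 ((StdForm.antidiagonal 3).over L) (κ k) ∈ K')
    (hωf : ∀ (k : finAdelic (↥(maximalRealSubfield L)) L (IsCMField.complexConj L) 3 ((StdForm.antidiagonal 3).over L)) (hk : k ∈ U₀), ω ⟨_, hKf k hk⟩ = 1)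
    (hωκ : ∀ k : K, ω ⟨_, hKκ k⟩ = χ k⁻¹) :
    (⨅ k : ↥K', Module.End.eigenspace ((((quasiSplit (↥(maximalRealSubfield L)) L (IsCMField.complexConj L) 3).rightRegular μ) (K'.subtype k) : (quasiSplit (↥(maximalRealSubfield L)) L (IsCMField.complexConj L) 3).L2 μ →L[ℂ] (quasiSplit (↥(maximalRealSubfield L)) L (IsCMField.complexConj L) 3).L2 μ) :
        (quasiSplit (↥(maximalRealSubfield L)) L (IsCMField.complexConj L) 3).L2 μ →ₗ[ℂ] (quasiSplit (↥(maximalRealSubfield L)) L (IsCMField.complexConj L) 3).L2 μ) (ω k)) ≤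
      LinearMap.eqLocus (P : (quasiSplit (↥(maximalRealSubfield L)) L (IsCMField.complexConj L) 3).L2 μ →ₗ[ℂ] (quasiSplit (↥(maximalRealSubfield L)) L (IsCMField.complexConj L) 3).L2 μ) LinearMap.id :=
  iInf_eigenspace_le_eqLocus_blockProjector (H := (StdForm.antidiagonal 3).over L) ((quasiSplit (↥(maximalRealSubfield L)) L (IsCMField.complexConj L) 3).rightRegular μ)
    ((quasiSplit (↥(maximalRealSubfield L)) L (IsCMField.complexConj L) 3).isUnitary_rightRegular μ)
    ((quasiSplit (↥(maximalRealSubfield L)) L (IsCMField.complexConj L) 3).isStronglyContinuous_rightRegular_holds μ) νf κ hκ μK χ e hχmul hχone U₀ he0 he1 heK P hPdef K' ω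
    hKf hKκ hωf hωκ


/-- **THE `hScP` LETTER OF ★ (N₃) `resG_isotypic_le_orthogonal_lines`, BY NAME ON THE G SIDE**: `resGBlock L μ K' ω χ₁ χ₂ ≤ eqLocus P id` — BLK-ISO₃ (§3, visible `hHK′`, `hχ₂`) composed with
`Iso(K′, ω) ≤ V_P` (§4, visible generator data `hKf hKκ hωf hωκ`). [cite: MoeglinWaldspurger1995, II.1.5] [cite: Knapp1986, VIII §3] -/
theorem resGBlock_le_eqLocus_blockProjector
    [MeasurableSpace (quasiSplit (↥(maximalRealSubfield L)) L (IsCMField.complexConj L) 3).Adelic] [BorelSpace (quasiSplit (↥(maximalRealSubfield L)) L (IsCMField.complexConj L) 3).Adelic]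
    (hχmul : ∀ k l, χ (k * l) = χ k * χ l) (hχone : χ 1 = 1)
    (U₀ : Subgroup (finAdelic (↥(maximalRealSubfield L)) L (IsCMField.complexConj L) 3 ((StdForm.antidiagonal 3).over L))) (he0 : ∀ g, g ∉ U₀ → e g = 0) (he1 : ∫ g, e g ∂νf = 1)
    (heK : ∀ k ∈ U₀, ∀ x, e (k * x) = e x)
    (P : (quasiSplit (↥(maximalRealSubfield L)) L (IsCMField.complexConj L) 3).L2 μ →L[ℂ] (quasiSplit (↥(maximalRealSubfield L)) L (IsCMField.complexConj L) 3).L2 μ)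
    (hPdef : P = ((((quasiSplit (↥(maximalRealSubfield L)) L (IsCMField.complexConj L) 3).rightRegular μ).restrict ((archToAdelic (↥(maximalRealSubfield L)) L (IsCMField.complexConj L) 3 ((StdForm.antidiagonal 3).over L)).comp κ)).integratedOperator (((quasiSplit (↥(maximalRealSubfield L)) L (IsCMField.complexConj L) 3).isUnitary_rightRegular μ).restrict _)
          (((quasiSplit (↥(maximalRealSubfield L)) L (IsCMField.complexConj L) 3).isStronglyContinuous_rightRegular_holds μ).restrict _ ((continuous_archToAdelic (↥(maximalRealSubfield L)) L (IsCMField.complexConj L) 3 ((StdForm.antidiagonal 3).over L)).comp hκ)) μK χ ∘L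
        (((quasiSplit (↥(maximalRealSubfield L)) L (IsCMField.complexConj L) 3).rightRegular μ).restrict (finAdelicToAdelic (↥(maximalRealSubfield L)) L (IsCMField.complexConj L) 3 ((StdForm.antidiagonal 3).over L))).integratedOperator (((quasiSplit (↥(maximalRealSubfield L)) L (IsCMField.complexConj L) 3).isUnitary_rightRegular μ).restrict _) (((quasiSplit (↥(maximalRealSubfield L)) L (IsCMField.complexConj L) 3).isStronglyContinuous_rightRegular_holds μ).restrict _ (continuous_finAdelicToAdelic (↥(maximalRealSubfield L)) L (IsCMField.complexConj L) 3 ((StdForm.antidiagonal 3).over L))) νf e))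
    (K' : Subgroup (quasiSplit (↥(maximalRealSubfield L)) L (IsCMField.complexConj L) 3).Adelic) (ω : ↥K' →* ℂ)
    (hKf : ∀ k ∈ U₀, finAdelicToAdelic (↥(maximalRealSubfield L)) L (IsCMField.complexConj L) 3 ((StdForm.antidiagonal 3).over L) k ∈ K')
    (hKκ : ∀ k : K, archToAdelic (↥(maximalRealSubfield L)) L (IsCMField.complexConj L) 3 ((StdForm.antidiagonal 3).over L) (κ k) ∈ K')
    (hωf : ∀ (k : finAdelic (↥(maximalRealSubfield L)) L (IsCMField.complexConj L) 3 ((StdForm.antidiagonal 3).over L)) (hk : k ∈ U₀), ω ⟨_, hKf k hk⟩ = 1)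
    (hωκ : ∀ k : K, ω ⟨_, hKκ k⟩ = χ k⁻¹)
    (hHK' : ∀ (g k : (quasiSplit (↥(maximalRealSubfield L)) L (IsCMField.complexConj L) 3).Adelic), k ∈ K' → borelHeight (g * k) = borelHeight g)
    (χ₁ : HeckeCharacter L) {χ₂ : ↥(TorusDict.torus (IsCMField.complexConj L)) →ₜ* ℂˣ} (hχ₂ : TorusDict.IsAutomorphic (IsCMField.complexConj L) χ₂) :
    resGBlock L μ K' ω χ₁ χ₂ ≤ LinearMap.eqLocus (P : (quasiSplit (↥(maximalRealSubfield L)) L (IsCMField.complexConj L) 3).L2 μ →ₗ[ℂ] (quasiSplit (↥(maximalRealSubfield L)) L (IsCMField.complexConj L) 3).L2 μ) LinearMap.id :=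
  (resGBlock_le_iInf_eigenspace L μ K' ω hHK' χ₁ hχ₂).trans
    (iso_le_eqLocus_blockProjector_quasiSplit_three L μ νf κ hκ μK χ e hχmul hχone U₀ he0 he1 heK P hPdef K' ω hKf hKκ hωf hωκ)

end Print

end Summit.HodgeConjecture.HodgeConjecture.R90.S8

end
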